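import Literature.NumberTheory.EllipticCurves.Rank1Residual.PrintShapeTorsion
import Literature.NumberTheory.EllipticCurves.HeegnerPoints
import HarnessLib

/-!
# Keller–Yin (arXiv:2402.12781v2): the `p`-part of BSD at Eisenstein primes of good reduction —
# the ANNOUNCED statements, typed as explicitly labelled OPEN hypotheses

HONEST FRAMING (cell `b2b-bsdres`, home `run/shared/lean/b2b/bsd-rank1-residual/`): the goal is to
DELETE the COMBINATION-SHAPED residual classes of the BSD formula for ALL analytic-rank `≤ 1`
curves over `ℚ` from PUBLISHED theorems only, and to TYPE what is not published; this is not
"finishing BSD". T. Keller, M. Yin, *On the anticyclotomic Iwasawa theory of newforms at Eisenstein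
primes of semistable reduction*, arXiv:2402.12781v2 (2024) is an UNREFEREED PREPRINT (no journal
version as of 2026-08-18). Nothing in this file is a theorem of the tree: the two `def … : Prop`
below transcribe (i) the announced Theorem 3 (= Thm. 4.2.1, p. 22) and (ii) the displayed identity
of its printed proof in analytic rank `1`, each with the suffix `_OPEN` and the tag
`[claim: KellerYin2024, status: under-review]`, to be taken as explicit hypotheses
`(hKY : KellerYin2024.…_OPEN)`. A result using one is conditional on an unrefereed claim. Which
links of Keller–Yin's proof ARE published, and which are not, is recorded link by link in the cell
file `b2b-bsdres-x1a/X1-CHAIN.md` and in the docstrings below; the rank-`0` line with its one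
unpublished input isolated is the tree theorem
`Literature.NumberTheory.EllipticCurves.KellerYin2024.bsdp_of_mazurMainConjecture_of_analyticRank_eq_zero`.

* `thm421_pPart_OPEN` — Thm. 4.2.1 (= Thm. 3 of the Introduction), verbatim: "Let `E/ℚ` be an
  elliptic curve and `p > 2` a prime of good reduction. Assume that `E` admits a cyclic `p`-isogeny
  with kernel `C = 𝔽_p(φ)` for some character `φ : G_ℚ → 𝔽_p^×` (equivalently, `E[p]` is
  reducible). Assume that `r_an(E) ∈ {0,1}`. Then the `p`-part of the BSD formula holds for `E/ℚ`,
  i.e., `ord_p(L^*(E/ℚ,1)/(Ω_E · Reg_{E/ℚ})) = ord_p(Tam(E/ℚ) · #Ш(E/ℚ)[p^∞] / (#E(ℚ)_tors)²)`.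
  Here, `L^*(E/ℚ,1)` denotes the leading Taylor coefficient of `L(E/ℚ,s)` at `s = 1`." Conclusion
  in the tree's print shape `Rank1Residual.PPart W p` (Yan–Zhu / Keller–Yin shape with the torsion
  term; `#Ш[p^∞]` and `#Ш` have the same `p`-adic valuation, `Ш` being finite by
  Gross–Zagier–Kolyvagin for `r_an ≤ 1`).
* `thm421_rankOne_display_OPEN` — the identity displayed in the proof of Thm. 4.2.1 (p. 22) for
  `r_an(E) = 1` and an auxiliary imaginary quadratic field `K` as in [CGLS] Thm. 5.3.1 (a)–(d)
  (`D_K < -4` odd, every `ℓ ∣ N` split, `p` split, `L(E^K,1) ≠ 0`): "equation (5.7) in [CGLS]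
  becomes `ord_p(L'(E,1)/(Reg(E/ℚ)·Ω_E·∏_ℓ c_ℓ(E/ℚ))) − ord_p(#Ш(E/ℚ)) + 2 ord_p(E(ℚ)_tors)
  = −( ord_p(L(E^K,1)/(Ω_{E^K}·∏_ℓ c_ℓ(E^K/ℚ))) − ord_p(#Ш(E^K/ℚ)) + 2 ord_p(E^K(ℚ)_tors) )`."
  Its printed derivation uses: Keller–Yin Thm. 3.0.11 (IMC2) [= Thm. 1; the anticyclotomic
  Iwasawa main conjecture at an Eisenstein prime WITHOUT the hypothesis `φ|_{G_p} ≠ 1, ω` of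
  [CGLS] Thm. 4.2.2 / [CGS] Thm. 6.5.3 (arXiv v1: 5.5.3) — PREPRINT], Keller–Yin Thm. 7.0.6
  [anticyclotomic control
  theorem allowing `E(K)[p] ≠ 0` — PREPRINT; the published [CGLS] Thm. 5.1.1 = [JSW] Thm. 3.3.1
  needs `E(K)[p] = 0` and `E(ℚ_p)[p] = 0`], and the PUBLISHED [CGLS] Thm. 5.1.2 (Gross–Zagier
  1986), Thm. 5.1.3 (Bertolini–Darmon–Prasanna 2013), Kolyvagin 1990, and the bookkeeping
  (5.5)–(5.7) (`Ш(E/K)[p^∞] = Ш(E)[p^∞] ⊕ Ш(E^K)[p^∞]`, `Σ_{w∣ℓ} ord_p c_w(E/K) = ord_p c_ℓ(E) +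
  ord_p c_ℓ(E^K)`, `ĥ(P_K) = [E(K):ℤP_K]² Reg(E/ℚ)`, `u_K = 1`, Manin constant cancelling).
  Keller–Yin then conclude "the right-hand side vanishes by [CGLS, Thm. 5.1.4], a result of
  Greenberg–Vatsal" — which holds when `E^K` satisfies (GV) (Greenberg–Vatsal 2000, Thm. 1.3:
  kernel character ramified-at-`p`-and-even or unramified-and-odd), i.e. when `E` itself does NOT
  (the twist by the odd, unramified-at-`p` character `χ_K` swaps the two parity types and preserves
  anomaly); otherwise the rank-`0` `p`-part of `E^K` needs Mazur's main conjecture at an anomalous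
  Eisenstein prime of the other type, which is not in print (see `AnomalousRankZeroProofs`).

Typing note: the anticyclotomic objects of links (IMC2)/(control)/(BDP) — the Greenberg
(`v`-relaxed, `v̄`-strict) Selmer group over the anticyclotomic tower and the BDP `p`-adic
`L`-function — have no definition in the tree (the prelude `PAdicBSD` deliberately states no BDP
predicate), so Thm. 3.0.11 and Thm. 7.0.6 are not transcribed separately; the display above is
their COMBINED printed consequence, stated on the two curves' BSD invariants only.

VERSION NOTE (locators). The quotations and numbers above were read from the literature store's
text `paper:arxiv-2402.12781`, which is arXiv **v1** (February 2024); its item numbers ("Thm. 3",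
"Thm. 3.0.11", "Thm. 7.0.6", "p. 22") are that extraction's (chunk pages; theorem counter not reset
at sections). In arXiv **v2** (30 October 2024; TeX source of record kept by the `bsd-eis` cell at
`run/shared/lean/pub/bsd-eis/lit/src/ky24-v2/main.tex`, concordance in that cell's `lit/INDEX.md`)
the Introduction's theorems are LETTERED: "Thm. 3" = Theorem C = Thm. 4.2.1 (label `BSD E`);
"Thm. 4 (imc mult)" = Theorem D = Thm. 5.1.3; "Thm. 3.0.11" = Thm. 3.0.8 (label `IMC`);
"Thm. 7.0.6" = Thm. B.0.2 (Appendix B, anticyclotomic control theorem); "§0.5" = §0.6 "Relation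
to previous works", whose sentence now reads "Thus it would automatically generalize the results
which require the main theorem in op. cit. as an input, for example [CGS, Theorem A]". Two changes
of substance in v2: (i) Theorems A, B and Thm. 3.0.8 are stated for weight `k = 2r` with `r` ODD
(Rem. 3.0.7: used only in the Kolyvagin-system existence Thm. 3.0.6); (ii) v2 ADDS an explicit,
unlabeled Theorem 3.0.10: "Let `E/ℚ` be an elliptic curve, and let `p > 2` be a prime of good
reduction for `E`. Suppose that `p` is Eisenstein. Then `𝔛_ord(E/ℚ_∞)` is `Λ_ℚ`-cotorsion with
`Char_{Λ_ℚ}(𝔛_ord(E/ℚ_∞)) = 𝓛_p^{MSD}(E/ℚ)`, and hence Mazur's Main Conjecture holds." with the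
two-sentence proof "This is the main result of [CGS]. Their technical assumption on the local
behaviors of the characters in the semisimplification of `E[p]` can be removed if one replaces the
appeal to [CGLS, Theorem 4.2.2, Corollary 4.2.3] by our Theorem 3.0.8 and Remark 3.0.9 (specialized
to weight 2 case)." So the anomalous cyclotomic main conjecture, described below and in
`AnomalousRankZeroProofs` as "asserted in §0.5 without a theorem", IS asserted as a theorem in v2,
with that proof; it remains an unrefereed claim and nothing in this file changes status. The
statement of Thm. 4.2.1 and the rank-one display are verbatim identical in v1 and v2.

## References
* T. Keller, M. Yin, arXiv:2402.12781, v1 (2024-02) and v2 (2024-10-30): v1 "Thm. 3 (p. 4) =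
  Thm. 4.2.1 and its proof (p. 22), Thm. 3.0.11, Thm. 7.0.6, §0.5" = v2 Theorem C = Thm. 4.2.1,
  Thm. 3.0.8, Thm. B.0.2, §0.6; v2 Thm. 3.0.10 (new). [KellerYin2024]
* F. Castella, G. Grossi, J. Lee, C. Skinner, Invent. Math. 227 (2022), §5 (Thms. 5.1.1–5.1.4,
  Thm. 5.3.1, (5.5)–(5.7)). [CastellaEtAl2021]
* F. Castella, G. Grossi, C. Skinner, Math. Ann. 393 (2025), Thm. D (§1.2), Thm. 6.5.3 (printed numbering;
  = arXiv v1 LaTeXML "Thm. 4" (§0.3), Thm. 5.5.3). [CastellaGrossiSkinner2025]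
* R. Greenberg, V. Vatsal, Invent. Math. 142 (2000), Thm. 1.3. [GreenbergVatsal2000]
-/

set_option autoImplicit false

noncomputable section

open scoped Classical

open WeierstrassCurve Literature.NumberTheory.EllipticCurves
  Literature.NumberTheory.EllipticCurves.Rank1Residual

namespace Literature.NumberTheory.EllipticCurves.KellerYin2024

/-- **OPEN HYPOTHESIS — UNREFEREED PREPRINT (arXiv:2402.12781v2, 2024).** Keller–Yin, Thm. 4.2.1
(= Thm. 3 of the Introduction): "Let `E/ℚ` be an elliptic curve and `p > 2` a prime of good
reduction. Assume that `E` admits a cyclic `p`-isogeny […] (equivalently, `E[p]` is reducible).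
Assume that `r_an(E) ∈ {0,1}`. Then the `p`-part of the BSD formula holds for `E/ℚ`, i.e.,
`ord_p(L^*(E/ℚ,1)/(Ω_E · Reg_{E/ℚ})) = ord_p(Tam(E/ℚ) · #Ш(E/ℚ)[p^∞] / (#E(ℚ)_tors)²)`."
Transcribed for a globally minimal model `W` (`Ω_E = W.realPeriodRat`), `p ≠ 2` of good reduction
(`HasGoodReductionAtPrime`), `E[p]` reducible (`¬ HasIrreducibleModPGaloisRep`), `W.analyticRank ≤ 1`,
with conclusion the print shape `Rank1Residual.PPart W p`
(`L^{(r)}(E,1)/(r!·Ω·Reg) = q ∈ ℚ`, `ord_p q = ord_p #Ш + ord_p ∏ c_ℓ − 2 ord_p #E(ℚ)_tors`).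
NEVER cite this `Prop` as a theorem; take it as an explicit hypothesis. Status of its printed proof:
see the module docstring (rank `1` of parity type (unramified-even)/(ramified-odd): Keller–Yin's
Thms. 3.0.11 + 7.0.6 + published inputs; rank `0`, and rank `1` of the other type: rests moreover on
Mazur's cyclotomic (MC) for an anomalous Eisenstein prime, asserted in §0.5 without a theorem;
see `AnomalousRankZeroProofs`). [claim: KellerYin2024, status: under-review] -/
def thm421_pPart_OPEN : Prop :=
  ∀ (W : WeierstrassCurve ℚ) [W.IsElliptic] [W.IsGloballyMinimal] (p : ℕ) [Fact p.Prime],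
    p ≠ 2 → W.HasGoodReductionAtPrime p → ¬ W.HasIrreducibleModPGaloisRep p →
      W.analyticRank ≤ 1 → PPart W p

/-- **OPEN HYPOTHESIS — UNREFEREED PREPRINT (arXiv:2402.12781v2, 2024), the rank-one display of the
proof of Thm. 4.2.1 (p. 22).** For `E/ℚ` (globally minimal `W`), `p ≠ 2` of good reduction with
`E[p]` reducible and `ord_{s=1} L(E,s) = 1`, and for every imaginary quadratic field `K` with
`D_K < -4` odd in which every prime dividing `N_E` splits and `p` splits, such that
`L(E^K, 1) ≠ 0` ([CGLS] Thm. 5.3.1, (a)–(d)), and every globally minimal model `Wd` of the twist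
`E^K = E^{(D_K)}`: "equation (5.7) in [CGLS] becomes
`ord_p(L'(E,1)/(Reg(E/ℚ)·Ω_E·∏_ℓ c_ℓ(E/ℚ))) − ord_p(#Ш(E/ℚ)) + 2 ord_p(E(ℚ)_tors)
 = −( ord_p(L(E^K,1)/(Ω_{E^K}·∏_ℓ c_ℓ(E^K/ℚ))) − ord_p(#Ш(E^K/ℚ)) + 2 ord_p(E^K(ℚ)_tors) )`",
stated for the rational numbers `q = L'(E,1)/(Ω_E·Reg(E/ℚ))` (rational by Gross–Zagier 1986,
Thm. I.7.3) and `qd = L(E^K,1)/Ω_{E^K}` (rational by Manin–Drinfeld), with `#Ш = shaOrder`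
(finite by Gross–Zagier–Kolyvagin). Printed derivation: Keller–Yin Thm. 3.0.11 (IMC2) and
Thm. 7.0.6 (control with torsion) — preprint — with the published Gross–Zagier formula,
Bertolini–Darmon–Prasanna formula and Kolyvagin's theorem ([CGLS] Thms. 5.1.2, 5.1.3, (5.5)–(5.7)).
NEVER cite this `Prop` as a theorem; take it as an explicit hypothesis.
[claim: KellerYin2024, status: under-review] -/
def thm421_rankOne_display_OPEN : Prop :=
  ∀ (W : WeierstrassCurve ℚ) [W.IsElliptic] [W.IsGloballyMinimal] (p : ℕ) [Fact p.Prime],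
    p ≠ 2 → W.HasGoodReductionAtPrime p → ¬ W.HasIrreducibleModPGaloisRep p →
      W.analyticRank = 1 →
    ∀ (K : Type) [Field K] [NumberField K], IsImaginaryQuadratic K →
      Odd (NumberField.discr K) → NumberField.discr K < -4 →
      SatisfiesHeegnerHypothesis (W.conductorNorm ℤ) K → SatisfiesHeegnerHypothesis p K →
      (W.quadraticTwist (NumberField.discr K : ℚ)).entireLFunction 1 ≠ 0 →
    ∀ (Wd : WeierstrassCurve ℚ) [Wd.IsElliptic] [Wd.IsGloballyMinimal],
      (∃ C : VariableChange ℚ, C • Wd = W.quadraticTwist (NumberField.discr K : ℚ)) →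
    ∀ (q qd : ℚ), W.leadingLCoeff / ((W.realPeriodRat * W.regulator : ℝ) : ℂ) = (q : ℂ) →
      Wd.entireLFunction 1 / (Wd.realPeriodRat : ℂ) = (qd : ℂ) →
      padicValRat p q - ((padicValNat p W.shaOrder : ℤ) + padicValNat p W.tamagawaProduct -
          2 * padicValNat p W.torsionOrder) =
        -(padicValRat p qd - ((padicValNat p Wd.shaOrder : ℤ) + padicValNat p Wd.tamagawaProduct -
          2 * padicValNat p Wd.torsionOrder))

end Literature.NumberTheory.EllipticCurves.KellerYin2024

end
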